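import Summits.HodgeConjecture.HodgeConjecture.Theorems.R90S6TwistedKappaOrbitalRegrouping   -- ★ K7 (K7.3) `negOnePow_log_detZero_eq_of_mem_twistedShell` (brings ★ L4, ★ J1′, ★ L2-sgn, ★ K3–K6, `detZero`)
import Summits.HodgeConjecture.HodgeConjecture.Theorems.R90S6EtaOnePartnerClosedForm         -- ★ TE5 (E5.1)/(E5.2) `etaOneGraphPartnerAlgHom_heckeDiag_one∕two_eq_sqrt_smul` (brings ★ W10 `η̂₁`, ★ TE-gen (N.2))
import Summits.HodgeConjecture.HodgeConjecture.Theorems.R90S6HSideEllipticValue              -- ★ H2 `orbitalIntegral_coeff_toVector_eq_mul_sum_ncard_displaced_two` (brings ★ A1-H, the tree `X₂` letters)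
import HarnessLib

/-!
# R90 · S6 «Ch. 14.1–14.5 stable trace formula» — card K8 FILE 1a (row E1.4.4.3.1): THE `η̂₁` TWISTED FUNDAMENTAL LEMMA AT THE FIRST HECKE SHELLS — THE TWO SIDES
# (`Theorems/R90S6EtaOneTwistedFLShellIdentity.lean`)

Dealer R90-C14-plan (g2): card K8-CENSUS 2026-09-05T02:39:54Z, census `R90/R90-C14-p08/g2/K8-CENSUS.md` 0fb7af7b27306b15, rulings 02:47:13Z ((J-a) «=»: in the
`Z′ = ⊥` currency the weight is `κ̃ = ω(det₀ α)` over ALL of `H¹(F, T)`; GO FILE 1 = (S.1) + (S.2) + (S.3) + consistency rung; split 1a = this ∕ 1b by the 400-line cap).  Seat R90-C14-p08 (g2).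
Print [Rogawski1990] §4.10 (4.10.1) p. 57, Prop. 4.10.1 (b) (4.10.3) p. 58: `Δ̃(δ)·Φ^κ̃_ε(δ, φ) = Φ^st(γ, φ^H)`, `φ^H = η̂₁(φ)` for `φ ∈ ℋ̃` (`E∕F` unramified),
`Δ̃(δ) = μ(det₀ δ)⁻¹ Δ_{G∕H}(γ)`, `κ(ν) = μ(det₀(t_ν))⁻¹` (Prop. 3.13.1).

## WHAT IS PROVED (all count-neutral bookkeeping over ★ carriers; the FL itself is proved by nobody here)
* §1 (S.1) G̃ SIDE, `Z′ = ⊥` CURRENCY — **`sum_negOnePow_log_detZero_mul_epsOrbitalIntegral_eq_negOnePow_mul_sum`**: over ★ L4's binders at `N = 3` with base points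
  `α_i·δ` (one cocycle per class of `H¹(F,T)`, `(α_i)₁₁ ≠ 0`), `Σ_i κ̃(α_i)·Φ_Θ(α_iδ, 1_{K̃ϖ^aK̃}) = (Σa + log v det δ).negOnePow · Σ_i ω((α_i)₁₁)·Φ_Θ(α_iδ, 1_{K̃ϖ^aK̃})`
  (`κ̃(α) = (log v det₀ α).negOnePow`, `ω(x) = (log v x).negOnePow`) — termwise ★ J1′ (empty shell ⇒ `0 = 0`) and ★ K7 (K7.3) at an inhabited shell; the generic
  two-weight selection lemma `sum_mul_epsOrbitalIntegral_indicator_eq_mul_sum_mul_of_selection` is ★ L4 §1's pattern.  UNCONDITIONAL; the shell COUNTS themselves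
  (`#{Λ : inv(Λ, P_{α_iδ}Λ) = a}` off the apartment, DAG row E1.4.4.2.2) are NOT ★ today and stay unevaluated `Set.ncard` terms (letters `V i` in FILE 1b).
* §2 (S.2) H SIDE AT THE ADIC PLACE, CLOSED — **`orbitalIntegral_etaOneGraphPartner_heckeDiag_one`** ∕ **`…_two`**: for `γ ∈ U(J₀,2)(E_w)` with compact centraliser,
  `O_γ^{ν∕ρ}(g ↦ (η̂₁ T_r [K₀])(gK₀)) = ν(K₀)·Σ_{k<2} √Q·#{x ∈ X₂(E_w) self-dual : d(x, γx) = 2k}` (`r = 1, 2`; ★ TE5 (E5.1)/(E5.2) `η̂₁T₁ = η̂₁T₂ = √Q•φ′₁ + √Q•1` fed to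
  ★ H2 `orbitalIntegral_coeff_toVector_eq_mul_sum_ncard_displaced_two`); **`orbitalIntegral_etaOneGraphPartner_heckeDiag_two_eq_one`** — the two H-side values coincide
  (★ TE-gen (N.2), no measure hypothesis).
* (S.3) HEAD (the `↔` anchor form at `λ = (1,0,0)`) and the FREE CONSISTENCY RUNG (`Σ_i κ̃Φ_Θ(α_iδ, c_{(1,0,0)}) = Σ_i κ̃Φ_Θ(α_iδ, c_{(1,1,0)})` from the two FL
  instances) are FILE 1b `Theorems/R90S6EtaOneTwistedFLShellAnchor.lean` (by import of this file; the 400-line cap splits the card).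
HONEST LABEL: the LHS counts are NOT ★ at elliptic `γ` (E1.4.4.2.2 undealt); nothing here proves (4.10.3) or discharges a citation; HC_CM is proved only modulo the 7
printed citations (2 remaining named inputs: hLiu418 = stmt-HodgeConjecture-24832, h413 = stmt-HodgeConjecture-24833) until rung 0 closes; REL ≠ ★ ≠ BUILT.
Lane `--kind proof --supports stmt-HodgeConjecture-24833 --as helper`; THEOREMS ONLY (no definition, no instance, no notation, no named fact, no kit, no `sorry`).

## Tree search (dedup)
`rg "EtaOneTwistedFL|orbitalIntegral_etaOneGraphPartner|etaOne_twistedFL|sum_mul_epsOrbitalIntegral_indicator_eq_mul_sum_mul_of_selection"` over `lean/` — no hit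
(2026-09-05T02:50Z); nearest ★ H2-adic `orbitalIntegral_satakeGraphPartner_torusGen_pow` (the `ξ̂_H` twin), ★ L4 §1 (one weight).

## References
* [Rogawski1990] J. D. Rogawski, *Automorphic Representations of Unitary Groups in Three Variables*, Ann. of Math. Stud. 123 (1990): §3.11 p. 35, §3.13 Prop. 3.13.1 p. 38,
  §4.9 p. 55 (`Δ_{G∕H}`), §4.10 (4.10.1)–(4.10.3) pp. 57–58, Prop. 4.10.2 p. 58.
* [Kottwitz1986BaseChangeUnits] R. E. Kottwitz, *Base change for unit elements of Hecke algebras*, Compositio Math. 60 (1986): §1 pp. 239–243.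
* [LabesseLanglands1979] J.-P. Labesse, R. P. Langlands, *L-indistinguishability for SL(2)*, Canad. J. Math. 31 (1979): §§2–3 (orbital integrals as tree counts).
* [CartierCorvallis1979] P. Cartier, *Representations of 𝔭-adic groups: a survey*, PSPM 33.1 (1979): §IV (4.2), Cor. 4.2.
-/

set_option autoImplicit false
-- the mandated namespace repeats the single-problem summit's segment (`HodgeConjecture.HodgeConjecture`)
set_option linter.dupNamespace false

noncomputable section

open MeasureTheory Measure Topology Set
open scoped ENNReal Matrix MatrixGroups WithZero Pointwise ValuativeRel
open NumberField IsDedekindDomain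
open Literature.MeasureTheory.Group Literature.NumberTheory.Automorphic Literature.NumberTheory.Automorphic.heckeAlgebra
  Literature.NumberTheory.Automorphic.HermitianLattice Literature.NumberTheory.Automorphic.HermitianLatticeTree
  Literature.NumberTheory.Automorphic.UnitaryGroup Literature.NumberTheory.Automorphic.CartanUnique
  Literature.NumberTheory.Rogawski1990.Ch4Sec10
open Literature.NumberTheory.Rogawski1990.Ch3Sec10to13 (detZero)
open Summit.HodgeConjecture.HodgeConjecture.Cruxes.HLiu418.K2LiuRankOneHeckeCellsTwo (rev_vecOne)

namespace Summit.HodgeConjecture.HodgeConjecture.R90.S6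

universe u

/-! ## §1 (S.1) The G̃ side in the `Z′ = ⊥` currency: `Σ κ̃·Φ_Θ = (Σa + log v det δ).negOnePow · Σ ω(α₁₁)·Φ_Θ` -/

section Generic

variable {G : Type*} [Group G] [TopologicalSpace G] [IsTopologicalGroup G] [LocallyCompactSpace G]
  [SecondCountableTopology G] [T2Space G] [MeasurableSpace G] [BorelSpace G]
  (ε : G →* G) (K : Subgroup G) {ι : Type*} (s : Finset ι) (d : ι → G)
  [∀ i, MeasurableSpace (G ⧸ epsCentralizer ε (d i))] [∀ i, BorelSpace (G ⧸ epsCentralizer ε (d i))]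
  [hC : ∀ i, IsClosed ((epsCentralizer ε (d i) : Subgroup G) : Set G)]
  (t : ∀ i, Measure (epsCentralizer ε (d i))) [∀ i, (t i).IsMulLeftInvariant]
  [∀ i, IsFiniteMeasureOnCompacts (t i)] [∀ i, (t i).IsOpenPosMeasure] [∀ i, (t i).IsInvInvariant] [∀ i, SFinite (t i)]
  (ν : Measure G) [IsHaarMeasure ν] [ν.IsMulRightInvariant]
  [∀ i, CompactSpace (epsCentralizer ε (d i))]
  (hε : Continuous ε) {S : Set G} (hS : IsOpen S) (hSK : ∀ k : G, k ∈ K → ∀ g : G, k * g * (ε k)⁻¹ ∈ S ↔ g ∈ S)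

include hε hS hSK in
/-- **Two-weight selection** (★ L4 §1's pattern with a second weight): if on every INHABITED twisted shell `κ_i = κ′_i · s₀`, then
`Σ_{i ∈ s} κ_i · Φ_ε(d_i, 1_S; ν∕t_i) = s₀ · Σ_{i ∈ s} κ′_i · Φ_ε(d_i, 1_S; ν∕t_i)` (an empty shell contributes `0` to both sides by ★ J1′
`epsOrbitalIntegral_indicator_quotientMeasure_eq_mul_ncard_shell`). [cite: Rogawski1990, §4.10 (4.10.1) p. 57] [cite: Kottwitz1986BaseChangeUnits, §1 pp. 239–243] -/
theorem sum_mul_epsOrbitalIntegral_indicator_eq_mul_sum_mul_of_selection (hK : IsOpen (K : Set G)) (ht : ∀ i ∈ s, t i Set.univ = 1)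
    (hfin : ∀ i ∈ s, {q : G ⧸ K | q.out⁻¹ * d i * ε q.out ∈ S}.Finite) (κ κ' : ι → ℤˣ) (s₀ : ℤˣ)
    (hsel : ∀ i ∈ s, {q : G ⧸ K | q.out⁻¹ * d i * ε q.out ∈ S}.Nonempty → κ i = κ' i * s₀) :
    ∑ i ∈ s, (((κ i : ℤˣ) : ℤ) : ℝ) *
        epsOrbitalIntegral ε (d i) (S.indicator (1 : G → ℝ)) (quotientMeasure (epsCentralizer ε (d i)) (t i) (hC i) ν) =
      (((s₀ : ℤˣ) : ℤ) : ℝ) *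
        ∑ i ∈ s, (((κ' i : ℤˣ) : ℤ) : ℝ) *
          epsOrbitalIntegral ε (d i) (S.indicator (1 : G → ℝ)) (quotientMeasure (epsCentralizer ε (d i)) (t i) (hC i) ν) := by
  rw [Finset.mul_sum]
  refine Finset.sum_congr rfl fun i hi => ?_
  rw [epsOrbitalIntegral_indicator_quotientMeasure_eq_mul_ncard_shell ε (d i) K (t i) ν hε hS hSK hK (ht i hi) (hfin i hi)]
  rcases ({q : G ⧸ K | q.out⁻¹ * d i * ε q.out ∈ S}).eq_empty_or_nonempty with h0 | hne
  · rw [h0, Set.ncard_empty, Nat.cast_zero, mul_zero, mul_zero, mul_zero, mul_zero]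
  · rw [hsel i hi hne, Units.val_mul, Int.cast_mul]
    ring

end Generic

section GTilde

variable {K : Type} [Field K] [Valued K ℤᵐ⁰] [ValuativeRel K] [(Valued.v : Valuation K ℤᵐ⁰).Compatible] {σ : K →+* K}
  {ϖ : K} (hϖ : IsUniformizingElement ϖ) (hvϖ : Valued.v ϖ = WithZero.exp (-1 : ℤ))

include hvϖ in
/-- **(S.1) THE G̃ SIDE IN THE `Z′ = ⊥` CURRENCY.**  ★ L4's binders at `N = 3` with base points `d_i = α_i·δ` (one cocycle `α_i` per class of `H¹(F, T)`; only `(α_i)₁₁ ≠ 0` is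
used — true for `α_i ∈ H̃`, ★ K5), any exponent vector `a`:
`Σ_{i ∈ s} κ̃(α_i)·Φ_Θ(α_iδ, 1_{K̃ϖ^aK̃}; ν∕t_i) = (Σ_j a_j + log v det δ).negOnePow · Σ_{i ∈ s} ω((α_i)₁₁)·Φ_Θ(α_iδ, 1_{K̃ϖ^aK̃}; ν∕t_i)`, `κ̃(α) = (log v det₀ α).negOnePow` (the
(4.10.1) weight «`κ(ν) = μ(det₀(t_ν))⁻¹`», ruling (J-a)), `ω((α)₁₁) = (log v α₁₁).negOnePow` (the `U(1)`-component sign) — §1's two-weight selection with ★ K7 (K7.3)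
`negOnePow_log_detZero_eq_of_mem_twistedShell` on inhabited shells.  In `Φ^κ̃_ε(δ, 1_{K̃ϖ^aK̃})` only the classes with `ord det(α_iδ) ≡ Σa` survive (★ L2-sgn) and they carry the
signs `ω((α_i)₁₁)` — the twisted analogue of the `(+,+,−,−)` pattern of the ordinary `κ`-side. [cite: Rogawski1990, §4.10 (4.10.1) p. 57; §3.13 Prop. 3.13.1 p. 38]
[cite: Kottwitz1986BaseChangeUnits, §1 pp. 239–243] -/
theorem sum_negOnePow_log_detZero_mul_epsOrbitalIntegral_eq_negOnePow_mul_sum [LocallyCompactSpace (GL (Fin 3) K)]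
    [SecondCountableTopology (GL (Fin 3) K)] [MeasurableSpace (GL (Fin 3) K)] [BorelSpace (GL (Fin 3) K)]
    (hvσ : ∀ a, Valued.v (σ a) = Valued.v a) {ι : Type*} (s : Finset ι) (α : ι → GL (Fin 3) K) (δ : GL (Fin 3) K) (a : Fin 3 → ℤ)
    [∀ i, MeasurableSpace (GL (Fin 3) K ⧸
      epsCentralizer (MonoidHom.mk' (UnitaryGroup.qsInvolution σ) (UnitaryGroup.qsInvolution_mul σ)) (α i * δ))]
    [∀ i, BorelSpace (GL (Fin 3) K ⧸
      epsCentralizer (MonoidHom.mk' (UnitaryGroup.qsInvolution σ) (UnitaryGroup.qsInvolution_mul σ)) (α i * δ))]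
    [hC : ∀ i, IsClosed ((epsCentralizer (MonoidHom.mk' (UnitaryGroup.qsInvolution σ) (UnitaryGroup.qsInvolution_mul σ)) (α i * δ) :
      Subgroup (GL (Fin 3) K)) : Set (GL (Fin 3) K))]
    (t : ∀ i, Measure (epsCentralizer (MonoidHom.mk' (UnitaryGroup.qsInvolution σ) (UnitaryGroup.qsInvolution_mul σ)) (α i * δ)))
    [∀ i, (t i).IsMulLeftInvariant] [∀ i, IsFiniteMeasureOnCompacts (t i)] [∀ i, (t i).IsOpenPosMeasure] [∀ i, (t i).IsInvInvariant]
    [∀ i, SFinite (t i)] (ν : Measure (GL (Fin 3) K)) [IsHaarMeasure ν] [ν.IsMulRightInvariant]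
    [∀ i, CompactSpace (epsCentralizer (MonoidHom.mk' (UnitaryGroup.qsInvolution σ) (UnitaryGroup.qsInvolution_mul σ)) (α i * δ))]
    (hΘ : Continuous ⇑(MonoidHom.mk' (UnitaryGroup.qsInvolution σ) (UnitaryGroup.qsInvolution_mul σ) : GL (Fin 3) K →* GL (Fin 3) K))
    (hK : IsOpen (glInt 3 K : Set (GL (Fin 3) K))) (ht : ∀ i ∈ s, t i Set.univ = 1)
    (hfin : ∀ i ∈ s, {q : GL (Fin 3) K ⧸ glInt 3 K |
      q.out⁻¹ * (α i * δ) * UnitaryGroup.qsInvolution σ q.out ∈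
        (glInt 3 K : Set (GL (Fin 3) K)) * {zpowDiagGL hϖ.ne_zero a} * (glInt 3 K : Set (GL (Fin 3) K))}.Finite)
    (h11 : ∀ i ∈ s, ((α i : GL (Fin 3) K) : Matrix (Fin 3) (Fin 3) K) 1 1 ≠ 0) :
    ∑ i ∈ s, ((((WithZero.log (Valued.v (detZero K (α i)))).negOnePow : ℤˣ) : ℤ) : ℝ) *
        epsOrbitalIntegral (MonoidHom.mk' (UnitaryGroup.qsInvolution σ) (UnitaryGroup.qsInvolution_mul σ)) (α i * δ)
          (((glInt 3 K : Set (GL (Fin 3) K)) * {zpowDiagGL hϖ.ne_zero a} * (glInt 3 K : Set (GL (Fin 3) K))).indicator (1 : GL (Fin 3) K → ℝ))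
          (quotientMeasure (epsCentralizer (MonoidHom.mk' (UnitaryGroup.qsInvolution σ) (UnitaryGroup.qsInvolution_mul σ)) (α i * δ))
            (t i) (hC i) ν) =
      ((((∑ j, a j + WithZero.log (Valued.v ((δ : GL (Fin 3) K) : Matrix (Fin 3) (Fin 3) K).det)).negOnePow : ℤˣ) : ℤ) : ℝ) *
        ∑ i ∈ s, ((((WithZero.log (Valued.v (((α i : GL (Fin 3) K) : Matrix (Fin 3) (Fin 3) K) 1 1))).negOnePow : ℤˣ) : ℤ) : ℝ) *
          epsOrbitalIntegral (MonoidHom.mk' (UnitaryGroup.qsInvolution σ) (UnitaryGroup.qsInvolution_mul σ)) (α i * δ)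
            (((glInt 3 K : Set (GL (Fin 3) K)) * {zpowDiagGL hϖ.ne_zero a} * (glInt 3 K : Set (GL (Fin 3) K))).indicator (1 : GL (Fin 3) K → ℝ))
            (quotientMeasure (epsCentralizer (MonoidHom.mk' (UnitaryGroup.qsInvolution σ) (UnitaryGroup.qsInvolution_mul σ)) (α i * δ))
              (t i) (hC i) ν) := by
  refine sum_mul_epsOrbitalIntegral_indicator_eq_mul_sum_mul_of_selection
    (MonoidHom.mk' (UnitaryGroup.qsInvolution σ) (UnitaryGroup.qsInvolution_mul σ)) (glInt 3 K) s (fun i => α i * δ) t ν hΘ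
    (isOpen_doubleCoset_of_isOpen hK _) (twistedConj_mem_doubleCoset_iff hvσ _) hK ht hfin _ _ _ fun i hi hne => ?_
  -- an inhabited twisted shell of `α_i δ`: ★ K7 (K7.3) gives `κ̃(α_i) = ω((α_i)₁₁) · (Σa + log v det δ).negOnePow`
  obtain ⟨q, hq⟩ := hne
  exact negOnePow_log_detZero_eq_of_mem_twistedShell hϖ hvϖ hvσ (h11 i hi) hq

end GTilde

/-! ## §2 (S.2) The H side at the adic place: `O_γ(η̂₁ T₁) = O_γ(η̂₁ T₂) = ν(K₀)·Σ_{k<2} √Q·#S_k(γ)` -/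

section HSide

variable {F E : Type} [Field F] [NumberField F] [Field E] [NumberField E] [Algebra F E] [Algebra.IsQuadraticExtension F E]
  (c : E ≃ₐ[F] E) (hc1 : c ≠ 1) (v : HeightOneSpectrum (𝓞 F)) (w : PlacesOver E v) (hw : c • w.1 = w.1)
  (hv : Algebra.IsUnramifiedIn (𝓞 E) v.asIdeal)
  -- the `GL₃` Hecke source of `η̂₁` (★ W10 ∕ TE5 binders VERBATIM)
  {K' : Type u} [Field K'] [ValuativeRel K'] [IsDiscreteValuationRing 𝒪[K']] [Finite 𝓀[K']] {ϖ' : K'}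
  [IsHeckeTriple (⊤ : Submonoid (GL (Fin 3) K')) (glInt 3 K') (glInt 3 K')]
  (hϖ' : IsUniformizingElement ϖ') {u : ℂˣ} (hu : (u : ℂ) ^ 2 = ((Nat.card 𝓀[K'] : ℕ) : ℂ))
  {wt : Multiplicative (Fin 3 → ℤ) →* ℂ}
  (hwt : ∀ e : Fin 3 → ℤ, wt (Multiplicative.ofAdd e) = ((u ^ ((((3 : ℕ) : ℤ) - 1) * (∑ i, e i) - 2 * satakeTwistExp e) : ℂˣ) : ℂ))
  (hqQ : ((Nat.card 𝓀[K'] : ℕ) : ℂ) = (Nat.card (Valued.ResidueField (w.1.adicCompletion E)) : ℂ))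
  -- the H side (★ H2-adic binders VERBATIM)
  (hA : ∀ M : Submodule 𝒪[w.1.adicCompletion E] (Fin 2 → w.1.adicCompletion E),
    IsSelfDualLattice (galAdicCompletionMap (L := E) c hw) ((StdForm.antidiagonal 2).over (w.1.adicCompletion E)) M →
      ∃ g : unitaryGroupOfForm (galAdicCompletionMap (L := E) c hw) ((StdForm.antidiagonal 2).over (w.1.adicCompletion E)),
        latt (((g : GL (Fin 2) (w.1.adicCompletion E))) : Matrix (Fin 2) (Fin 2) (w.1.adicCompletion E)) = M)
  [LocallyCompactSpace (unitaryGroupOfForm (galAdicCompletionMap (L := E) c hw) ((StdForm.antidiagonal 2).over (w.1.adicCompletion E)))]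
  [SecondCountableTopology (unitaryGroupOfForm (galAdicCompletionMap (L := E) c hw) ((StdForm.antidiagonal 2).over (w.1.adicCompletion E)))]
  [MeasurableSpace (unitaryGroupOfForm (galAdicCompletionMap (L := E) c hw) ((StdForm.antidiagonal 2).over (w.1.adicCompletion E)))]
  [BorelSpace (unitaryGroupOfForm (galAdicCompletionMap (L := E) c hw) ((StdForm.antidiagonal 2).over (w.1.adicCompletion E)))]
  (γ : unitaryGroupOfForm (galAdicCompletionMap (L := E) c hw) ((StdForm.antidiagonal 2).over (w.1.adicCompletion E)))
  [MeasurableSpace (unitaryGroupOfForm (galAdicCompletionMap (L := E) c hw) ((StdForm.antidiagonal 2).over (w.1.adicCompletion E)) ⧸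
    Subgroup.centralizer ({γ} : Set (unitaryGroupOfForm (galAdicCompletionMap (L := E) c hw) ((StdForm.antidiagonal 2).over (w.1.adicCompletion E)))))]
  [BorelSpace (unitaryGroupOfForm (galAdicCompletionMap (L := E) c hw) ((StdForm.antidiagonal 2).over (w.1.adicCompletion E)) ⧸
    Subgroup.centralizer ({γ} : Set (unitaryGroupOfForm (galAdicCompletionMap (L := E) c hw) ((StdForm.antidiagonal 2).over (w.1.adicCompletion E)))))]
  [hC : IsClosed ((Subgroup.centralizer ({γ} : Set (unitaryGroupOfForm (galAdicCompletionMap (L := E) c hw) ((StdForm.antidiagonal 2).over (w.1.adicCompletion E)))) :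
    Subgroup (unitaryGroupOfForm (galAdicCompletionMap (L := E) c hw) ((StdForm.antidiagonal 2).over (w.1.adicCompletion E)))) :
      Set (unitaryGroupOfForm (galAdicCompletionMap (L := E) c hw) ((StdForm.antidiagonal 2).over (w.1.adicCompletion E))))]
  (ρ : Measure (Subgroup.centralizer ({γ} : Set (unitaryGroupOfForm (galAdicCompletionMap (L := E) c hw) ((StdForm.antidiagonal 2).over (w.1.adicCompletion E))))))
  [ρ.IsMulLeftInvariant] [IsFiniteMeasureOnCompacts ρ] [ρ.IsOpenPosMeasure] [ρ.IsInvInvariant] [SFinite ρ]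
  (ν : Measure (unitaryGroupOfForm (galAdicCompletionMap (L := E) c hw) ((StdForm.antidiagonal 2).over (w.1.adicCompletion E))))
  [IsHaarMeasure ν] [ν.IsMulRightInvariant]
  [CompactSpace (Subgroup.centralizer ({γ} : Set (unitaryGroupOfForm (galAdicCompletionMap (L := E) c hw) ((StdForm.antidiagonal 2).over (w.1.adicCompletion E)))))]
  (hρ : ρ Set.univ = 1)

include hqQ hA hρ in
/-- **(S.2) THE H-SIDE VALUE OF `η̂₁ T₁` AT `γ`** (inert unramified place `w ∣ v`; `γ ∈ U(J₀,2)(E_w)` with compact centraliser of `ρ`-mass one; `ν` Haar; finitely many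
self-dual vertices of `X₂(E_w)` displaced by `0` and by `2`): `O_γ^{ν∕ρ}(g ↦ (η̂₁ T₁ [K₀])(gK₀)) = ν(K₀) · Σ_{k < 2} √Q · #{x ∈ X₂(E_w) self-dual : d(x, γx) = 2k}` (`√Q = q_v`,
`T₁ = 1_{K̃ diag(ϖ′,1,1) K̃} = c_{(1,0,0)}` of `ℋ(GL₃(K′), GL₃(𝒪′))` at the junction `hqQ`; `η̂₁ = ` ★ `etaOneGraphPartnerAlgHom`): ★ TE5 (E5.1) (`η̂₁T₁ = √Q•φ′₁ + √Q•1`, `φ′₁ = 1_{K₀tK₀}`,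
`t = diag(ϖ_w, ϖ_w⁻¹)`) fed to ★ H2 `orbitalIntegral_coeff_toVector_eq_mul_sum_ncard_displaced_two` at `m = 1`.  The compact `U(1)`-factor of `H_w` multiplies by its volume (E1.3.7.2).
[cite: Rogawski1990, §4.10 Prop. 4.10.1 (b) p. 58; §4.9 p. 55] [cite: LabesseLanglands1979, §§2–3] [cite: CartierCorvallis1979, §IV Cor. 4.2] -/
theorem orbitalIntegral_etaOneGraphPartner_heckeDiag_one
    (hfin : ∀ k ≤ 1, {x : {M : Submodule 𝒪[w.1.adicCompletion E] (Fin 2 → w.1.adicCompletion E) //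
        IsSpecialLattice (galAdicCompletionMap (L := E) c hw) (localConjUniformizer c hc1 v w hw hv)
          ((StdForm.antidiagonal 2).over (w.1.adicCompletion E)) M} |
        IsSelfDualLattice (galAdicCompletionMap (L := E) c hw) ((StdForm.antidiagonal 2).over (w.1.adicCompletion E)) x.1 ∧
          (latticeTree (galAdicCompletionMap (L := E) c hw) (localConjUniformizer c hc1 v w hw hv)
              ((StdForm.antidiagonal 2).over (w.1.adicCompletion E))).dist x
            (latticeTreeIso (galAdicCompletionMap (L := E) c hw) (localConjUniformizer c hc1 v w hw hv)
              ((StdForm.antidiagonal 2).over (w.1.adicCompletion E)) γ x) = 2 * k}.Finite) :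
    haveI := isHeckeTriple_unitaryInt_adicCompletion c v w hw ((StdForm.antidiagonal 2).over (w.1.adicCompletion E))
    orbitalIntegral γ
        (fun x : unitaryGroupOfForm (galAdicCompletionMap (L := E) c hw) ((StdForm.antidiagonal 2).over (w.1.adicCompletion E)) =>
          (toVector (unitaryInt (galAdicCompletionMap (L := E) c hw) ((StdForm.antidiagonal 2).over (w.1.adicCompletion E)))
            (etaOneGraphPartnerAlgHom c hc1 v w hw hv hϖ' hu hwt
              (doubleCosetOperator (glInt 3 K') (heckeDiag 3 (Units.mk0 ϖ' hϖ'.ne_zero) 1)))).coeff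
          (x : unitaryGroupOfForm (galAdicCompletionMap (L := E) c hw) ((StdForm.antidiagonal 2).over (w.1.adicCompletion E)) ⧸
            unitaryInt (galAdicCompletionMap (L := E) c hw) ((StdForm.antidiagonal 2).over (w.1.adicCompletion E))))
        (quotientMeasure (Subgroup.centralizer ({γ} : Set (unitaryGroupOfForm (galAdicCompletionMap (L := E) c hw)
          ((StdForm.antidiagonal 2).over (w.1.adicCompletion E))))) ρ hC ν) =
      (ν (unitaryInt (galAdicCompletionMap (L := E) c hw) ((StdForm.antidiagonal 2).over (w.1.adicCompletion E)))).toReal *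
        ∑ k ∈ Finset.range 2, ((Nat.sqrt (Nat.card (Valued.ResidueField (w.1.adicCompletion E))) : ℕ) : ℂ) *
          ({x : {M : Submodule 𝒪[w.1.adicCompletion E] (Fin 2 → w.1.adicCompletion E) //
              IsSpecialLattice (galAdicCompletionMap (L := E) c hw) (localConjUniformizer c hc1 v w hw hv)
                ((StdForm.antidiagonal 2).over (w.1.adicCompletion E)) M} |
              IsSelfDualLattice (galAdicCompletionMap (L := E) c hw) ((StdForm.antidiagonal 2).over (w.1.adicCompletion E)) x.1 ∧
                (latticeTree (galAdicCompletionMap (L := E) c hw) (localConjUniformizer c hc1 v w hw hv)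
                    ((StdForm.antidiagonal 2).over (w.1.adicCompletion E))).dist x
                  (latticeTreeIso (galAdicCompletionMap (L := E) c hw) (localConjUniformizer c hc1 v w hw hv)
                    ((StdForm.antidiagonal 2).over (w.1.adicCompletion E)) γ x) = 2 * k}.ncard : ℂ) := by
  haveI := isHeckeTriple_unitaryInt_adicCompletion c v w hw ((StdForm.antidiagonal 2).over (w.1.adicCompletion E))
  have hνK : ν (unitaryInt (galAdicCompletionMap (L := E) c hw) ((StdForm.antidiagonal 2).over (w.1.adicCompletion E))) ≠ ∞ :=
    (isCompact_unitaryInt_adicCompletion c v w hw ((StdForm.antidiagonal 2).over (w.1.adicCompletion E))).measure_lt_top.ne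
  -- ★ TE5 (E5.1) at `t′ = diag(ϖ_w, ϖ_w⁻¹) ∈ U(J₀,2)(E_w)` for the chosen uniformiser carrying the unramified datum: `η̂₁ T₁ = √Q • φ′₁ + √Q • 1`
  have h51 := etaOneGraphPartnerAlgHom_heckeDiag_one_eq_sqrt_smul c hc1 v w hw hv hϖ' hu hwt
    (unramifiedLocalConjDatum_localConjUniformizer c hc1 v w hw hv)
    (⟨zpowDiagGL (uniformizer_ne_zero (unramifiedLocalConjDatum_localConjUniformizer c hc1 v w hw hv).vϖ) ![(1 : ℤ), -1],
      zpowDiagGL_mem_unitaryGroupOfForm (unramifiedLocalConjDatum_localConjUniformizer c hc1 v w hw hv).σϖ _ rev_vecOne⟩ :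
      ↥(unitaryGroupOfForm (galAdicCompletionMap (L := E) c hw) ((StdForm.antidiagonal 2).over (w.1.adicCompletion E))))
    rfl hqQ
  -- … `= Σ_{k<2} √Q • 1_{K₀ t′ᵏ K₀}` (`t′⁰ = 1`, ★ `doubleCosetOperator_one`)
  have hsum : (∑ k ∈ Finset.range (1 + 1), (fun _ : ℕ => ((Nat.sqrt (Nat.card (Valued.ResidueField (w.1.adicCompletion E))) : ℕ) : ℂ)) k •
      doubleCosetOperator (k := ℂ) (unitaryInt (galAdicCompletionMap (L := E) c hw) ((StdForm.antidiagonal 2).over (w.1.adicCompletion E)))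
        ((⟨zpowDiagGL (uniformizer_ne_zero (unramifiedLocalConjDatum_localConjUniformizer c hc1 v w hw hv).vϖ) ![(1 : ℤ), -1],
          zpowDiagGL_mem_unitaryGroupOfForm (unramifiedLocalConjDatum_localConjUniformizer c hc1 v w hw hv).σϖ _ rev_vecOne⟩ :
          ↥(unitaryGroupOfForm (galAdicCompletionMap (L := E) c hw) ((StdForm.antidiagonal 2).over (w.1.adicCompletion E)))) ^ k)) =
      ((Nat.sqrt (Nat.card (Valued.ResidueField (w.1.adicCompletion E))) : ℕ) : ℂ) •
          doubleCosetOperator (k := ℂ) (unitaryInt (galAdicCompletionMap (L := E) c hw) ((StdForm.antidiagonal 2).over (w.1.adicCompletion E)))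
            (⟨zpowDiagGL (uniformizer_ne_zero (unramifiedLocalConjDatum_localConjUniformizer c hc1 v w hw hv).vϖ) ![(1 : ℤ), -1],
              zpowDiagGL_mem_unitaryGroupOfForm (unramifiedLocalConjDatum_localConjUniformizer c hc1 v w hw hv).σϖ _ rev_vecOne⟩ :
              ↥(unitaryGroupOfForm (galAdicCompletionMap (L := E) c hw) ((StdForm.antidiagonal 2).over (w.1.adicCompletion E)))) +
        ((Nat.sqrt (Nat.card (Valued.ResidueField (w.1.adicCompletion E))) : ℕ) : ℂ) • 1 := by
    simp only [Finset.sum_range_succ, Finset.sum_range_zero, zero_add, pow_zero, pow_one, doubleCosetOperator_one]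
    exact add_comm _ _
  exact orbitalIntegral_coeff_toVector_eq_mul_sum_ncard_displaced_two (unramifiedLocalConjDatum_localConjUniformizer c hc1 v w hw hv)
    (⟨zpowDiagGL (uniformizer_ne_zero (unramifiedLocalConjDatum_localConjUniformizer c hc1 v w hw hv).vϖ) ![(1 : ℤ), -1],
      zpowDiagGL_mem_unitaryGroupOfForm (unramifiedLocalConjDatum_localConjUniformizer c hc1 v w hw hv).σϖ _ rev_vecOne⟩ :
      ↥(unitaryGroupOfForm (galAdicCompletionMap (L := E) c hw) ((StdForm.antidiagonal 2).over (w.1.adicCompletion E))))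
    rfl hA γ ρ ν hρ hνK 1 (fun _ => ((Nat.sqrt (Nat.card (Valued.ResidueField (w.1.adicCompletion E))) : ℕ) : ℂ)) _ (h51.trans hsum.symm) hfin

include hqQ hA hρ in
/-- **(S.2′) THE H-SIDE VALUE OF `η̂₁ T₂` AT `γ`** — the same number (`T₂ = c_{(1,1,0)}`; ★ TE5 (E5.2) `η̂₁T₂ = √Q•φ′₁ + √Q•1`).
[cite: Rogawski1990, §4.10 Prop. 4.10.1 (b), Prop. 4.10.2 p. 58] [cite: LabesseLanglands1979, §§2–3] -/
theorem orbitalIntegral_etaOneGraphPartner_heckeDiag_two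
    (hfin : ∀ k ≤ 1, {x : {M : Submodule 𝒪[w.1.adicCompletion E] (Fin 2 → w.1.adicCompletion E) //
        IsSpecialLattice (galAdicCompletionMap (L := E) c hw) (localConjUniformizer c hc1 v w hw hv)
          ((StdForm.antidiagonal 2).over (w.1.adicCompletion E)) M} |
        IsSelfDualLattice (galAdicCompletionMap (L := E) c hw) ((StdForm.antidiagonal 2).over (w.1.adicCompletion E)) x.1 ∧
          (latticeTree (galAdicCompletionMap (L := E) c hw) (localConjUniformizer c hc1 v w hw hv)
              ((StdForm.antidiagonal 2).over (w.1.adicCompletion E))).dist x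
            (latticeTreeIso (galAdicCompletionMap (L := E) c hw) (localConjUniformizer c hc1 v w hw hv)
              ((StdForm.antidiagonal 2).over (w.1.adicCompletion E)) γ x) = 2 * k}.Finite) :
    haveI := isHeckeTriple_unitaryInt_adicCompletion c v w hw ((StdForm.antidiagonal 2).over (w.1.adicCompletion E))
    orbitalIntegral γ
        (fun x : unitaryGroupOfForm (galAdicCompletionMap (L := E) c hw) ((StdForm.antidiagonal 2).over (w.1.adicCompletion E)) =>
          (toVector (unitaryInt (galAdicCompletionMap (L := E) c hw) ((StdForm.antidiagonal 2).over (w.1.adicCompletion E)))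
            (etaOneGraphPartnerAlgHom c hc1 v w hw hv hϖ' hu hwt
              (doubleCosetOperator (glInt 3 K') (heckeDiag 3 (Units.mk0 ϖ' hϖ'.ne_zero) 2)))).coeff
          (x : unitaryGroupOfForm (galAdicCompletionMap (L := E) c hw) ((StdForm.antidiagonal 2).over (w.1.adicCompletion E)) ⧸
            unitaryInt (galAdicCompletionMap (L := E) c hw) ((StdForm.antidiagonal 2).over (w.1.adicCompletion E))))
        (quotientMeasure (Subgroup.centralizer ({γ} : Set (unitaryGroupOfForm (galAdicCompletionMap (L := E) c hw)
          ((StdForm.antidiagonal 2).over (w.1.adicCompletion E))))) ρ hC ν) =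
      (ν (unitaryInt (galAdicCompletionMap (L := E) c hw) ((StdForm.antidiagonal 2).over (w.1.adicCompletion E)))).toReal *
        ∑ k ∈ Finset.range 2, ((Nat.sqrt (Nat.card (Valued.ResidueField (w.1.adicCompletion E))) : ℕ) : ℂ) *
          ({x : {M : Submodule 𝒪[w.1.adicCompletion E] (Fin 2 → w.1.adicCompletion E) //
              IsSpecialLattice (galAdicCompletionMap (L := E) c hw) (localConjUniformizer c hc1 v w hw hv)
                ((StdForm.antidiagonal 2).over (w.1.adicCompletion E)) M} |
              IsSelfDualLattice (galAdicCompletionMap (L := E) c hw) ((StdForm.antidiagonal 2).over (w.1.adicCompletion E)) x.1 ∧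
                (latticeTree (galAdicCompletionMap (L := E) c hw) (localConjUniformizer c hc1 v w hw hv)
                    ((StdForm.antidiagonal 2).over (w.1.adicCompletion E))).dist x
                  (latticeTreeIso (galAdicCompletionMap (L := E) c hw) (localConjUniformizer c hc1 v w hw hv)
                    ((StdForm.antidiagonal 2).over (w.1.adicCompletion E)) γ x) = 2 * k}.ncard : ℂ) := by
  haveI := isHeckeTriple_unitaryInt_adicCompletion c v w hw ((StdForm.antidiagonal 2).over (w.1.adicCompletion E))
  rw [etaOneGraphPartnerAlgHom_heckeDiag_two c hc1 v w hw hv hϖ' hu hwt]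
  exact orbitalIntegral_etaOneGraphPartner_heckeDiag_one c hc1 v w hw hv hϖ' hu hwt hqQ hA γ ρ ν hρ hfin

end HSide

section HSideEq

variable {F E : Type} [Field F] [NumberField F] [Field E] [NumberField E] [Algebra F E] [Algebra.IsQuadraticExtension F E]
  (c : E ≃ₐ[F] E) (hc1 : c ≠ 1) (v : HeightOneSpectrum (𝓞 F)) (w : PlacesOver E v) (hw : c • w.1 = w.1)
  (hv : Algebra.IsUnramifiedIn (𝓞 E) v.asIdeal)
  {K' : Type u} [Field K'] [ValuativeRel K'] [IsDiscreteValuationRing 𝒪[K']] [Finite 𝓀[K']] {ϖ' : K'}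
  [IsHeckeTriple (⊤ : Submonoid (GL (Fin 3) K')) (glInt 3 K') (glInt 3 K')]
  (hϖ' : IsUniformizingElement ϖ') {u : ℂˣ} (hu : (u : ℂ) ^ 2 = ((Nat.card 𝓀[K'] : ℕ) : ℂ))
  {wt : Multiplicative (Fin 3 → ℤ) →* ℂ}
  (hwt : ∀ e : Fin 3 → ℤ, wt (Multiplicative.ofAdd e) = ((u ^ ((((3 : ℕ) : ℤ) - 1) * (∑ i, e i) - 2 * satakeTwistExp e) : ℂˣ) : ℂ))
  (γ : unitaryGroupOfForm (galAdicCompletionMap (L := E) c hw) ((StdForm.antidiagonal 2).over (w.1.adicCompletion E)))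
  [MeasurableSpace (unitaryGroupOfForm (galAdicCompletionMap (L := E) c hw) ((StdForm.antidiagonal 2).over (w.1.adicCompletion E)) ⧸
    Subgroup.centralizer ({γ} : Set (unitaryGroupOfForm (galAdicCompletionMap (L := E) c hw) ((StdForm.antidiagonal 2).over (w.1.adicCompletion E)))))]

/-- **The two H-side orbital integrals coincide** — `η̂₁ T₂ = η̂₁ T₁` (★ TE-gen (N.2)) as FUNCTIONS, against any measure `m` on `U(J₀,2)(E_w) ⧸ C(γ)` (no finiteness,
no Haar hypothesis). [cite: Rogawski1990, §4.10 Prop. 4.10.2 p. 58] -/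
theorem orbitalIntegral_etaOneGraphPartner_heckeDiag_two_eq_one
    (m : Measure (unitaryGroupOfForm (galAdicCompletionMap (L := E) c hw) ((StdForm.antidiagonal 2).over (w.1.adicCompletion E)) ⧸
      Subgroup.centralizer ({γ} : Set (unitaryGroupOfForm (galAdicCompletionMap (L := E) c hw) ((StdForm.antidiagonal 2).over (w.1.adicCompletion E)))))) :
    haveI := isHeckeTriple_unitaryInt_adicCompletion c v w hw ((StdForm.antidiagonal 2).over (w.1.adicCompletion E))
    orbitalIntegral γ
        (fun x : unitaryGroupOfForm (galAdicCompletionMap (L := E) c hw) ((StdForm.antidiagonal 2).over (w.1.adicCompletion E)) =>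
          (toVector (unitaryInt (galAdicCompletionMap (L := E) c hw) ((StdForm.antidiagonal 2).over (w.1.adicCompletion E)))
            (etaOneGraphPartnerAlgHom c hc1 v w hw hv hϖ' hu hwt
              (doubleCosetOperator (glInt 3 K') (heckeDiag 3 (Units.mk0 ϖ' hϖ'.ne_zero) 2)))).coeff
          (x : unitaryGroupOfForm (galAdicCompletionMap (L := E) c hw) ((StdForm.antidiagonal 2).over (w.1.adicCompletion E)) ⧸
            unitaryInt (galAdicCompletionMap (L := E) c hw) ((StdForm.antidiagonal 2).over (w.1.adicCompletion E)))) m =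
      orbitalIntegral γ
        (fun x : unitaryGroupOfForm (galAdicCompletionMap (L := E) c hw) ((StdForm.antidiagonal 2).over (w.1.adicCompletion E)) =>
          (toVector (unitaryInt (galAdicCompletionMap (L := E) c hw) ((StdForm.antidiagonal 2).over (w.1.adicCompletion E)))
            (etaOneGraphPartnerAlgHom c hc1 v w hw hv hϖ' hu hwt
              (doubleCosetOperator (glInt 3 K') (heckeDiag 3 (Units.mk0 ϖ' hϖ'.ne_zero) 1)))).coeff
          (x : unitaryGroupOfForm (galAdicCompletionMap (L := E) c hw) ((StdForm.antidiagonal 2).over (w.1.adicCompletion E)) ⧸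
            unitaryInt (galAdicCompletionMap (L := E) c hw) ((StdForm.antidiagonal 2).over (w.1.adicCompletion E)))) m := by
  haveI := isHeckeTriple_unitaryInt_adicCompletion c v w hw ((StdForm.antidiagonal 2).over (w.1.adicCompletion E))
  rw [etaOneGraphPartnerAlgHom_heckeDiag_two c hc1 v w hw hv hϖ' hu hwt]

end HSideEq

end Summit.HodgeConjecture.HodgeConjecture.R90.S6

end
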